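import Mathlib
import Summits.Ventures.PercRepro.TriangleCapLayerWitnessValue

/-!
# PercRepro — THE ROW WITNESS: THE LAYER WITNESS WITH AN ARBITRARY DISTRIBUTION OF LEFT ENDS (p3, gen 51;
part 237)

`rowWitness n a r t m lf` is `K_{a, n−a}` minus the `(r − t)`-star at `0` minus the `t` cross pairs
`{lf i, rEnd n a m i}` (`i < t`): the left end of the `i`-th off-pair is an ARBITRARY small-side vertex `lf i`
(`1 ≤ lf i < a`), the right end the leaf `a + i` (`i < m`) or the non-leaf `n − 1 − (i − m)`.  Part 230's layer
witness is the case `lf = lEnd a u`.  The structure is the same — `K₄⁻`-free, `a`-bipartite, the missing graph `H`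
has `deg H 0 = r − t`, `offEdges H 0` = the off-pairs (`t` of them), `attach H 0 = m` — and the intersecting pairs
are now the ordered pairs of indices with the same left end (`offAdjPairs_rowWitness`: two off-pairs share a vertex
iff they share their left end, the right ends being distinct): `offAdjPairs H 0 = coll t lf`, the collision count.
The intersecting-pair count and the value are in the next module (part 237b).  Axioms: standard.
-/

namespace PercRepro

namespace TriangleCap

namespace C047

open Finset

/-- The off-diagonal of an image under a map injective on the set is the image of the off-diagonal. -/
theorem offDiag_image_of_injOn {α β : Type*} [DecidableEq α] [DecidableEq β] {s : Finset α} {f : α → β}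
    (hf : Set.InjOn f ↑s) : (s.image f).offDiag = s.offDiag.image (Prod.map f f) := by
  ext ⟨x, y⟩
  simp only [mem_offDiag, mem_image, Prod.map_apply, Prod.mk.injEq, Prod.exists]
  constructor
  · rintro ⟨⟨i, hi, rfl⟩, ⟨i', hi', rfl⟩, hne⟩
    exact ⟨i, i', ⟨hi, hi', fun h => hne (by rw [h])⟩, rfl, rfl⟩
  · rintro ⟨i, i', ⟨hi, hi', hne⟩, rfl, rfl⟩
    exact ⟨⟨i, hi, rfl⟩, ⟨i', hi', rfl⟩, fun h => hne (hf hi hi' h)⟩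

/-- The cardinality of a filtered image under a map injective on the set. -/
theorem card_filter_image_of_injOn {α β : Type*} [DecidableEq β] {s : Finset α} {f : α → β}
    (hf : Set.InjOn f ↑s) (p : β → Prop) [DecidablePred p] :
    ((s.image f).filter p).card = (s.filter (fun a => p (f a))).card := by
  rw [filter_image]
  exact card_image_of_injOn (hf.mono (coe_subset.mpr (filter_subset _ _)))

/-- The ordered pairs of distinct indices `i, i' < t` with the same left end. -/
def coll (t : ℕ) (lf : ℕ → ℕ) : ℕ :=
  ((range t).offDiag.filter (fun p : ℕ × ℕ => lf p.1 = lf p.2)).card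

/-- The `i`-th off-pair of the row witness. -/
def rowPair (n a m : ℕ) (hn : 0 < n) (lf : ℕ → ℕ) (i : ℕ) : Sym2 (Fin n) :=
  s(fin' n hn (lf i), fin' n hn (rEnd n a m i))

/-- The `t` off-pairs of the row witness. -/
def rowPairs (n a t m : ℕ) (hn : 0 < n) (lf : ℕ → ℕ) : Finset (Sym2 (Fin n)) := (range t).image (rowPair n a m hn lf)

/-- **THE ROW WITNESS:** `K_{a, n−a}` minus the `(r − t)`-star at `0` minus the `t` off-pairs with left ends `lf`. -/
def rowWitness (n a r t m : ℕ) (hn : 0 < n) (lf : ℕ → ℕ) : SimpleGraph (Fin n) :=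
  delEdges (bipMinusStar n a (r - t)) (rowPairs n a t m hn lf)

/-- Adjacency in the row witness is decidable. -/
instance decidableRelRowWitness (n a r t m : ℕ) (hn : 0 < n) (lf : ℕ → ℕ) :
    DecidableRel (rowWitness n a r t m hn lf).Adj :=
  inferInstanceAs (DecidableRel (delEdges (bipMinusStar n a (r - t)) (rowPairs n a t m hn lf)).Adj)

/-- Membership in the `i`-th off-pair (`i < t`). -/
theorem mem_rowPair_iff (n a r t m : ℕ) (hn : 0 < n) (lf : ℕ → ℕ) (hlf : ∀ i, i < t → 1 ≤ lf i ∧ lf i < a) (i : ℕ)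
    (hi : i < t) (hr : t + m ≤ r) (han : a + r ≤ n) (v : Fin n) :
    v ∈ rowPair n a m hn lf i ↔ v.val = lf i ∨ v.val = rEnd n a m i := by
  unfold rowPair
  rw [Sym2.mem_iff, Fin.ext_iff, Fin.ext_iff, fin'_val n hn _ (by have := hlf i hi; omega),
    fin'_val n hn _ (rEnd_lt n a r t m i hi hr han)]

/-- The vertex `0` lies in no off-pair. -/
theorem zero_notMem_rowPair (n a r t m : ℕ) (hn : 0 < n) (lf : ℕ → ℕ) (hlf : ∀ i, i < t → 1 ≤ lf i ∧ lf i < a)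
    (i : ℕ) (hi : i < t) (hr : t + m ≤ r) (han : a + r ≤ n) : fin' n hn 0 ∉ rowPair n a m hn lf i := by
  rw [mem_rowPair_iff n a r t m hn lf hlf i hi hr han, fin'_val n hn 0 hn]
  have h1 := hlf i hi
  have h2 := le_rEnd n a r t m i hi hr han
  omega

/-- Two off-pairs (`i, i' < t`) agree iff their indices agree. -/
theorem rowPair_eq_iff (n a r t m : ℕ) (hn : 0 < n) (lf : ℕ → ℕ) (hlf : ∀ i, i < t → 1 ≤ lf i ∧ lf i < a)
    (i i' : ℕ) (hi : i < t) (hi' : i' < t) (hr : t + m ≤ r) (han : a + r ≤ n) :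
    rowPair n a m hn lf i = rowPair n a m hn lf i' ↔ i = i' := by
  constructor
  · intro h
    unfold rowPair at h
    rw [Sym2.eq_iff, Fin.ext_iff, Fin.ext_iff, Fin.ext_iff, Fin.ext_iff,
      fin'_val n hn _ (by have := hlf i hi; omega), fin'_val n hn _ (rEnd_lt n a r t m i hi hr han),
      fin'_val n hn _ (by have := hlf i' hi'; omega), fin'_val n hn _ (rEnd_lt n a r t m i' hi' hr han)] at h
    rcases h with ⟨-, h2⟩ | ⟨h1, -⟩
    · exact rEnd_inj n a r t m i i' hi hi' hr han h2
    · have := hlf i hi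
      have := le_rEnd n a r t m i' hi' hr han
      omega
  · rintro rfl
    rfl

/-- Membership in the off-pairs. -/
theorem mem_rowPairs (n a t m : ℕ) (hn : 0 < n) (lf : ℕ → ℕ) (e : Sym2 (Fin n)) :
    e ∈ rowPairs n a t m hn lf ↔ ∃ i, i < t ∧ rowPair n a m hn lf i = e := by
  unfold rowPairs
  simp only [mem_image, mem_range]

/-- **`|rowPairs| = t`.** -/
theorem card_rowPairs (n a r t m : ℕ) (hn : 0 < n) (lf : ℕ → ℕ) (hlf : ∀ i, i < t → 1 ≤ lf i ∧ lf i < a)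
    (hr : t + m ≤ r) (han : a + r ≤ n) : (rowPairs n a t m hn lf).card = t := by
  unfold rowPairs
  rw [card_image_of_injOn, card_range]
  intro i hi i' hi' h
  simp only [coe_range, Set.mem_Iio] at hi hi'
  exact (rowPair_eq_iff n a r t m hn lf hlf i i' hi hi' hr han).mp h

/-- An off-pair is a cross pair not at `0`. -/
theorem rowPair_cross (n a r t m : ℕ) (hn : 0 < n) (lf : ℕ → ℕ) (hlf : ∀ i, i < t → 1 ≤ lf i ∧ lf i < a)
    (hr : t + m ≤ r) (han : a + r ≤ n) (x y : Fin n) (h : s(x, y) ∈ rowPairs n a t m hn lf) :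
    (1 ≤ x.val ∧ x.val < a ∧ a ≤ y.val) ∨ (1 ≤ y.val ∧ y.val < a ∧ a ≤ x.val) := by
  rw [mem_rowPairs] at h
  obtain ⟨i, hi, he⟩ := h
  unfold rowPair at he
  rw [Sym2.eq_iff, Fin.ext_iff, Fin.ext_iff, Fin.ext_iff, Fin.ext_iff,
    fin'_val n hn _ (by have := hlf i hi; omega), fin'_val n hn _ (rEnd_lt n a r t m i hi hr han)] at he
  have h1 := hlf i hi
  have h3 := le_rEnd n a r t m i hi hr han
  rcases he with ⟨hx, hy⟩ | ⟨hx, hy⟩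
  · left; omega
  · right; omega

/-- The row witness is `K₄⁻`-free. -/
theorem k4mFree_rowWitness (n a r t m : ℕ) (hn : 0 < n) (lf : ℕ → ℕ) : K4mFree (rowWitness n a r t m hn lf) :=
  k4mFree_of_le _ _ (delEdges_le _ _) (k4mFree_bipMinusStar n a (r - t))

/-- The row witness is a spanning subgraph of `K(A, Aᶜ)`, `A = {i < a}`. -/
theorem bipSub_rowWitness (n a r t m : ℕ) (hn : 0 < n) (lf : ℕ → ℕ) :
    BipSub (rowWitness n a r t m hn lf) (leftPart n a) :=
  fun x y h => bipMinusStar_bipartite n a (r - t) x y h.1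

/-- Adjacency in the missing graph of the row witness on a cross pair `x < a ≤ y`. -/
theorem missingGraph_rowWitness_adj (n a r t m : ℕ) (hn : 0 < n) (lf : ℕ → ℕ) (x y : Fin n) (hx : x.val < a)
    (hy : a ≤ y.val) :
    (missingGraph (rowWitness n a r t m hn lf) (leftPart n a)).Adj x y ↔
      (x.val = 0 ∧ y.val < a + (r - t)) ∨ s(x, y) ∈ rowPairs n a t m hn lf := by
  rw [missingGraph_adj]
  unfold rowWitness
  rw [delEdges_adj, bipMinusStar_adj]
  simp only [leftPart, mem_filter, mem_univ, true_and]
  constructor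
  · rintro ⟨-, h⟩
    by_cases hS : s(x, y) ∈ rowPairs n a t m hn lf
    · exact Or.inr hS
    · left
      by_contra hc
      apply h
      refine ⟨⟨Or.inl ⟨hx, by omega⟩, ?_⟩, hS⟩
      rintro (⟨h1, h2, h3⟩ | ⟨h1, -, -⟩)
      · exact hc ⟨h1, h3⟩
      · omega
  · intro h
    refine ⟨⟨fun _ => by omega, fun _ => hx⟩, ?_⟩
    rintro ⟨⟨-, h2⟩, hS⟩
    rcases h with ⟨h1, h3⟩ | h
    · exact h2 (Or.inl ⟨h1, hy, h3⟩)
    · exact hS h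

/-- The neighbourhood of `0` in the missing graph is the star `rightStar n a (r − t)`. -/
theorem filter_adj_missingGraph_rowWitness (n a r t m : ℕ) (hn : 0 < n) (lf : ℕ → ℕ) (ha : 1 ≤ a)
    (hlf : ∀ i, i < t → 1 ≤ lf i ∧ lf i < a) (hr : t + m ≤ r) (han : a + r ≤ n) :
    univ.filter (fun v => (missingGraph (rowWitness n a r t m hn lf) (leftPart n a)).Adj (fin' n hn 0) v) =
      rightStar n a (r - t) := by
  ext v
  simp only [mem_filter, mem_univ, true_and, rightStar]
  by_cases hv : v.val < a
  · rw [missingGraph_adj]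
    simp only [leftPart, mem_filter, mem_univ, true_and, fin'_val n hn 0 hn]
    constructor
    · rintro ⟨h, -⟩
      exact absurd hv ((h.mp (by omega)))
    · intro h; omega
  · rw [missingGraph_rowWitness_adj n a r t m hn lf _ v (by rw [fin'_val n hn 0 hn]; omega) (by omega),
      fin'_val n hn 0 hn]
    constructor
    · rintro (⟨-, h⟩ | h)
      · exact ⟨by omega, h⟩
      · exfalso
        rw [mem_rowPairs] at h
        obtain ⟨i, hi, he⟩ := h
        have := zero_notMem_rowPair n a r t m hn lf hlf i hi hr han
        rw [he] at this
        exact this (Sym2.mem_mk_left _ _)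
    · rintro ⟨-, h⟩
      exact Or.inl ⟨rfl, h⟩

/-- `deg H 0 = r − t` in the missing graph of the row witness. -/
theorem deg_missingGraph_rowWitness_zero (n a r t m : ℕ) (hn : 0 < n) (lf : ℕ → ℕ) (ha : 1 ≤ a)
    (hlf : ∀ i, i < t → 1 ≤ lf i ∧ lf i < a) (hr : t + m ≤ r) (han : a + r ≤ n) :
    deg (missingGraph (rowWitness n a r t m hn lf) (leftPart n a)) (fin' n hn 0) = r - t := by
  unfold deg
  rw [filter_adj_missingGraph_rowWitness n a r t m hn lf ha hlf hr han, card_rightStar n a (r - t) (by omega)]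

/-- The off-edges of `0` in the missing graph are exactly the off-pairs. -/
theorem offEdges_missingGraph_rowWitness (n a r t m : ℕ) (hn : 0 < n) (lf : ℕ → ℕ) (ha : 1 ≤ a)
    (hlf : ∀ i, i < t → 1 ≤ lf i ∧ lf i < a) (hr : t + m ≤ r) (han : a + r ≤ n) :
    offEdges (missingGraph (rowWitness n a r t m hn lf) (leftPart n a)) (fin' n hn 0) = rowPairs n a t m hn lf := by
  ext e
  rw [mem_offEdges, SimpleGraph.mem_edgeFinset]
  refine Sym2.ind (fun x y => ?_) e
  rw [SimpleGraph.mem_edgeSet, Sym2.mem_iff]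
  constructor
  · rintro ⟨hadj, h0⟩
    have hcross := (missingGraph_adj _ _ x y).mp hadj
    simp only [leftPart, mem_filter, mem_univ, true_and] at hcross
    have h0x : x.val ≠ 0 := fun h => h0 (Or.inl (Fin.ext (by rw [fin'_val n hn 0 hn]; exact h.symm)))
    have h0y : y.val ≠ 0 := fun h => h0 (Or.inr (Fin.ext (by rw [fin'_val n hn 0 hn]; exact h.symm)))
    by_cases hx : x.val < a
    · have hy : a ≤ y.val := by
        have := hcross.1.mp hx
        omega
      rcases (missingGraph_rowWitness_adj n a r t m hn lf x y hx hy).mp hadj with ⟨h1, -⟩ | h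
      · exact absurd h1 h0x
      · exact h
    · have hy : y.val < a := by
        by_contra hy
        exact hx (hcross.1.mpr hy)
      rcases (missingGraph_rowWitness_adj n a r t m hn lf y x hy (by omega)).mp
        ((missingGraph _ _).adj_symm hadj) with ⟨h1, -⟩ | h
      · exact absurd h1 h0y
      · rw [Sym2.eq_swap]
        exact h
  · intro h
    have hc := rowPair_cross n a r t m hn lf hlf hr han x y h
    refine ⟨?_, ?_⟩
    · rcases hc with ⟨h1, h2, h3⟩ | ⟨h1, h2, h3⟩
      · exact (missingGraph_rowWitness_adj n a r t m hn lf x y h2 h3).mpr (Or.inr h)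
      · exact (missingGraph _ _).adj_symm
          ((missingGraph_rowWitness_adj n a r t m hn lf y x h2 h3).mpr (Or.inr (by rw [Sym2.eq_swap]; exact h)))
    · rintro (hx | hy)
      · rw [Fin.ext_iff, fin'_val n hn 0 hn] at hx
        omega
      · rw [Fin.ext_iff, fin'_val n hn 0 hn] at hy
        omega

/-- The missing graph has `r` edges. -/
theorem card_edges_missingGraph_rowWitness (n a r t m : ℕ) (hn : 0 < n) (lf : ℕ → ℕ) (ha : 1 ≤ a)
    (hlf : ∀ i, i < t → 1 ≤ lf i ∧ lf i < a) (hr : t + m ≤ r) (han : a + r ≤ n) :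
    (missingGraph (rowWitness n a r t m hn lf) (leftPart n a)).edgeFinset.card = r := by
  have h := card_offEdges_add_deg (missingGraph (rowWitness n a r t m hn lf) (leftPart n a)) (fin' n hn 0)
  rw [offEdges_missingGraph_rowWitness n a r t m hn lf ha hlf hr han, card_rowPairs n a r t m hn lf hlf hr han,
    deg_missingGraph_rowWitness_zero n a r t m hn lf ha hlf hr han] at h
  omega

/-- The edge count of the row witness: `|E| + r = a (n − a)`. -/
theorem card_edges_rowWitness (n a r t m : ℕ) (hn : 0 < n) (lf : ℕ → ℕ) (ha : 1 ≤ a)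
    (hlf : ∀ i, i < t → 1 ≤ lf i ∧ lf i < a) (hr : t + m ≤ r) (han : a + r ≤ n) :
    (rowWitness n a r t m hn lf).edgeFinset.card + r = a * (n - a) := by
  have h1 := sum_deg_eq (rowWitness n a r t m hn lf)
  have h2 := sum_deg_eq (missingGraph (rowWitness n a r t m hn lf) (leftPart n a))
  rw [card_edges_missingGraph_rowWitness n a r t m hn lf ha hlf hr han] at h2
  have h3 : ∑ v, (deg (rowWitness n a r t m hn lf) v +
      deg (missingGraph (rowWitness n a r t m hn lf) (leftPart n a)) v) =
      ∑ v, (if v ∈ leftPart n a then Fintype.card (Fin n) - (leftPart n a).card else (leftPart n a).card) :=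
    sum_congr rfl (fun v _ => deg_add_deg_missingGraph _ _ (bipSub_rowWitness n a r t m hn lf) v)
  rw [sum_add_distrib, sum_ite_mem_card, card_leftPart n a (by omega), Fintype.card_fin,
    Nat.mul_comm (n - a) a] at h3
  omega

/-- **`attach = m`** for the row witness. -/
theorem attach_rowWitness (n a r t m : ℕ) (hn : 0 < n) (lf : ℕ → ℕ) (ha : 1 ≤ a) (hlf : ∀ i, i < t → 1 ≤ lf i ∧ lf i < a)
    (hm : m ≤ t) (hr : t + m ≤ r) (han : a + r ≤ n) :
    attach (missingGraph (rowWitness n a r t m hn lf) (leftPart n a)) (fin' n hn 0) = m := by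
  have hN := filter_adj_missingGraph_rowWitness n a r t m hn lf ha hlf hr han
  have hmem : ∀ v, (missingGraph (rowWitness n a r t m hn lf) (leftPart n a)).Adj (fin' n hn 0) v ↔
      a ≤ v.val ∧ v.val < a + (r - t) := by
    intro v
    rw [Finset.ext_iff] at hN
    have := hN v
    simpa only [mem_filter, mem_univ, true_and, rightStar] using this
  rw [attach_eq_sum_card, offEdges_missingGraph_rowWitness n a r t m hn lf ha hlf hr han]
  unfold rowPairs
  rw [sum_image (fun i hi i' hi' h => by
    simp only [coe_range, Set.mem_Iio] at hi hi'
    exact (rowPair_eq_iff n a r t m hn lf hlf i i' hi hi' hr han).mp h)]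
  have hterm : ∀ i ∈ range t,
      (univ.filter (fun v => (missingGraph (rowWitness n a r t m hn lf) (leftPart n a)).Adj (fin' n hn 0) v ∧
        v ∈ rowPair n a m hn lf i)).card = if i < m then 1 else 0 := by
    intro i hi
    rw [mem_range] at hi
    have h1 := hlf i hi
    have h2 := le_rEnd n a r t m i hi hr han
    have h3 := rEnd_lt_iff n a r t m i hi hr han
    have h4 := rEnd_lt n a r t m i hi hr han
    by_cases him : i < m
    · rw [if_pos him]
      have : univ.filter (fun v => (missingGraph (rowWitness n a r t m hn lf) (leftPart n a)).Adj (fin' n hn 0) v ∧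
          v ∈ rowPair n a m hn lf i) = {fin' n hn (rEnd n a m i)} := by
        ext v
        simp only [mem_filter, mem_univ, true_and, mem_singleton, hmem,
          mem_rowPair_iff n a r t m hn lf hlf i hi hr han, Fin.ext_iff, fin'_val n hn _ h4]
        omega
      rw [this, card_singleton]
    · rw [if_neg him]
      rw [card_eq_zero, filter_eq_empty_iff]
      intro v _
      simp only [hmem, mem_rowPair_iff n a r t m hn lf hlf i hi hr han]
      omega
  rw [sum_congr rfl hterm, sum_boole, Nat.cast_id]
  have : (range t).filter (fun i => i < m) = range m := by
    ext i
    simp only [mem_filter, mem_range]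
    omega
  rw [this, card_range]

/-- `coll t lf ≤ t (t − 1)`. -/
theorem coll_le (t : ℕ) (lf : ℕ → ℕ) : coll t lf ≤ t * (t - 1) := by
  unfold coll
  have h := card_le_card (filter_subset (fun p : ℕ × ℕ => lf p.1 = lf p.2) (range t).offDiag)
  rw [offDiag_card, card_range] at h
  have := Nat.le_mul_self t
  rcases Nat.eq_zero_or_pos t with rfl | hpos
  · simp
  · obtain ⟨t', rfl⟩ : ∃ t', t = t' + 1 := ⟨t - 1, by omega⟩
    rw [Nat.add_sub_cancel]
    have e : (t' + 1) * (t' + 1) - (t' + 1) = (t' + 1) * t' := by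
      have : (t' + 1) * (t' + 1) = (t' + 1) * t' + (t' + 1) := by ring
      omega
    rw [e] at h
    exact h

end C047

end TriangleCap

end PercRepro
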